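import Summits.AtomisticToContinuum.Crystallization.Theorems.ChartedPlanarOrderProfileSlavingLJ

/-!
# Nash force balance: at every atom of a separated single-site-Nash LJ configuration the pair forces sum to zero (decomp-a2c lens-3 g22)

Blocker `N = ChartedPlanarOrder.ChartedZeroExcessLayered`, PS column (critic rows 413 (2), 419 (1)):
`ProfileSlavingLJ Λ η ⟸ SlavingKernelL1 (E1, proved) ∧ NashBalance Λ (D1) ∧ TubeMonotone Λ η (W)`, and
`NashBalance Λ ⟸ LayerForceBalance Λ (D1a) ∧ StraddleSummable Λ (D1s)` (module `…ProfileSlavingLJBalance`).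
This module proves the ANALYTIC CORE of D1a — first for an arbitrary configuration (no layering, no charts, no `Λ`), then layer-resolved:

* `nash_force_balance` ★ : for `0 < δ`, `IsSep δ S`, `IsNash (μS S)` and `p ∈ S`,
  `HasSum (fun q : {q // μS S {q} ≠ 0 ∧ q ≠ p} => pairForce (p − q)) 0`
  — the Lennard–Jones forces exerted on `p` by all other atoms form an (absolutely) convergent series with sum `0`.
  The index type is LITERALLY the one of `IsNash` (`ChartedPlanarOrderRigidityDoor`), and `pairForce x = (‖x‖⁻¹⁴ − ‖x‖⁻⁸) • x =
  −∇(V_LJ ∘ ‖·‖)(x)` is the tree's (`…ProfileSlavingLJ.pairForce`, normalisation `V_LJ(r) = r⁻¹²/12 − r⁻⁶/6` = `lennardJones`).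

Proof (all in this file, Mathlib only): §1 `V_LJ` is differentiable on `r ≠ 0` with `|V_LJ'(r)| ≤ r⁻¹³ + r⁻⁷`; §2 the pair term
`y ↦ V_LJ(‖y − q‖)` has Fréchet derivative `pairDeriv y q = −⟨pairForce (y − q), ·⟩` at `y ≠ q`; §3 on the ball `B(p, δ/2)` every pair
derivative is dominated by `K_δ ‖p − q‖⁻⁶`, so by `hasFDerivAt_tsum_of_isPreconnected` N's single-site energy
`siteEnergy S p y = ∑' q, V_LJ(dist y q)` is differentiable at `p` with derivative `∑' q, pairDeriv p q`; single-site Nash stationarity says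
`p` is a local minimiser of `siteEnergy S p` on `B(p, δ/2)` (every `y` there avoids the other atoms, which are at distance `≥ δ` from `p`), so the
derivative vanishes (`IsLocalMin.hasFDerivAt_eq_zero`), and the Riesz isometry `innerSL` turns this into `∑ pairForce = 0`; §4 discharges
the only analytic input, `Summable (‖p − q‖⁻⁶)` over a `δ`-separated set, by the injective grid map `q ↦ ⌊(2/δ) q⌋ ∈ ℤ³` and the termwise
comparison `‖p − q‖⁻⁶ ≤ (4/δ)⁶ ∏ᵢ (1 + |kᵢ − kᵢ(p)|)⁻²` with a summable product weight on `ℤ³`.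

* `hasSum_layerForce_of_isNash` ★ (§5): for a STACKED layered set `Layered a b w` (`IsStacked a b w`) with INDEPENDENT periods
  (`LinearIndependent ℝ ![a, b]`), `δ`-separated and single-site Nash, and given the in-layer cancellation `layerForce a b 0 = 0`
  (= `layerForce_neg` of `…ProfileSlavingLJBalance` at `v = 0`), for every layer `m`:
  `HasSum (fun l : {l // l ≠ m} => layerForce a b (w m − w l)) 0` — LITERALLY the conclusion of D1a `LayerForceBalance`.
  Proof: the parametrisation `(l, i, j) ↦ (i a + j b) + w l` is a bijection `ℤ × ℤ × ℤ → Layered a b w` (heights along the stacking normal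
  are strictly increasing in `l`; independence in-plane), so `nash_force_balance` at `p = w m` transports (`Function.Injective.hasSum_iff`,
  own term `pairForce 0 = 0` re-inserted by `Finset.hasSum_compl_iff`) to `HasSum F 0` on `ℤ × ℤ × ℤ`; each fibre `l` is summable
  (`Summable.prod_factor`) with sum `layerForce a b (w m − w l)` (reindex by `Equiv.neg (ℤ × ℤ)`), so `HasSum.prod_fiberwise` gives
  `HasSum (l ↦ layerForce a b (w m − w l)) 0` on `ℤ`, and the own layer drops out by `layerForce a b 0 = 0`.
  `IsClean` is NOT used here: in D1a's binder list it serves only to force the independence of the periods.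

Consequently D1a in tree currency reads `LayerForceBalance Λ ⟸ CleanStackedIndependent Λ` (the owed lemma «separated ∧ clean ∧ stacked
layered ⇒ `LinearIndependent ℝ ![a, b]`», booked prover-side by critic row 425 (1)) — a 3-line corollary once `…ProfileSlavingLJBalance`
(`LayerForceBalance`, `layerForce_neg`) and this module are both in the tree (corollary module `…ProfileSlavingLJLayerBalance`).

No new obligations, no instances, no notation; `E3`, `μS`, `IsSep`, `IsNash`, `pairForce`, `lennardJones` are the tree's.
-/

noncomputable section

open MeasureTheory Set Metric Filter Topology
open scoped RealInnerProductSpace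
open Summit.AtomisticToContinuum.Crystallization.Theorems.ChartedPlanarOrderRigidityDoor
open Summit.AtomisticToContinuum.Crystallization.Theorems.ChartedPlanarOrderDensityDichotomy
open Summit.AtomisticToContinuum.Crystallization.Theorems.ChartedPlanarOrderMesoCut
open Summit.AtomisticToContinuum.Crystallization.Theorems.ChartedPlanarOrderProfileSlavingLJ (pairForce layerForce IsStacked)
open Summit.AtomisticToContinuum.Crystallization.Theorems.ChartedPlanarOrderDoorLayered (Layered)
open Literature.MathematicalPhysics.StatisticalMechanics (lennardJones)

namespace Summit.AtomisticToContinuum.Crystallization.Theorems.ChartedPlanarOrderNashForceBalance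

/-! ## 1. One-variable calculus of `V_LJ` -/

/-- `V_LJ'(r) = −r⁻¹³ + r⁻⁷`. -/
def ljDeriv (r : ℝ) : ℝ := -(r⁻¹) ^ 13 + (r⁻¹) ^ 7

/-- `V_LJ` is differentiable away from `0` with derivative `ljDeriv`. -/
theorem hasDerivAt_lennardJones {r : ℝ} (hr : r ≠ 0) : HasDerivAt lennardJones (ljDeriv r) r := by
  have hinv : HasDerivAt (fun y : ℝ => y⁻¹) (-(r ^ 2)⁻¹) r := hasDerivAt_inv hr
  have h12 := ((hasDerivAt_pow 12 r⁻¹).comp r hinv).const_mul (1 / 12 : ℝ)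
  have h6 := ((hasDerivAt_pow 6 r⁻¹).comp r hinv).const_mul (1 / 6 : ℝ)
  have h := h12.sub h6
  refine (h.congr_of_eventuallyEq (Eventually.of_forall fun y => ?_)).congr_deriv ?_
  · simp [lennardJones, Function.comp]
  · simp only [ljDeriv, ← inv_pow]
    ring

/-- `|V_LJ'(r)| ≤ r⁻¹³ + r⁻⁷` for `r > 0`. -/
theorem abs_ljDeriv_le {r : ℝ} (hr : 0 < r) : |ljDeriv r| ≤ (r⁻¹) ^ 13 + (r⁻¹) ^ 7 := by
  have h1 : 0 ≤ (r⁻¹) ^ 13 := pow_nonneg (inv_nonneg.mpr hr.le) _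
  have h2 : 0 ≤ (r⁻¹) ^ 7 := pow_nonneg (inv_nonneg.mpr hr.le) _
  unfold ljDeriv
  rw [abs_le]; constructor <;> linarith

/-! ## 2. The pair term `y ↦ V_LJ(‖y − q‖)` and its derivative -/

/-- derivative of the norm away from the origin: `D‖·‖(x) = ‖x‖⁻¹ • ⟨x, ·⟩`. -/
theorem hasFDerivAt_norm_sub {x q : E3} (hx : x ≠ q) :
    HasFDerivAt (fun y : E3 => ‖y - q‖) (‖x - q‖⁻¹ • innerSL ℝ (x - q)) x := by
  have hsub : HasFDerivAt (fun y : E3 => y - q) (ContinuousLinearMap.id ℝ E3) x := (hasFDerivAt_id x).sub_const q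
  have hsq := hsub.norm_sq
  have hpos : 0 < ‖x - q‖ := norm_pos_iff.mpr (sub_ne_zero.mpr hx)
  have hne : ‖x - q‖ ^ 2 ≠ 0 := by positivity
  have hsqrt : HasDerivAt (fun s : ℝ => Real.sqrt s) (1 / (2 * Real.sqrt (‖x - q‖ ^ 2))) (‖x - q‖ ^ 2) := Real.hasDerivAt_sqrt hne
  have h := hsqrt.comp_hasFDerivAt x hsq
  refine (h.congr_of_eventuallyEq (Eventually.of_forall fun y => ?_)).congr_fderiv ?_
  · simp [Function.comp, Real.sqrt_sq (norm_nonneg _)]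
  · rw [Real.sqrt_sq (norm_nonneg _)]
    ext v
    simp only [_root_.smul_apply, ContinuousLinearMap.comp_apply, ContinuousLinearMap.id_apply, smul_eq_mul,
      nsmul_eq_mul]
    push_cast
    field_simp

/-- the derivative of the pair term: `D(V_LJ(‖· − q‖))(x) = (V'(r)/r) • ⟨x − q, ·⟩`, `r = ‖x − q‖`. -/
def pairDeriv (x q : E3) : E3 →L[ℝ] ℝ := (ljDeriv ‖x - q‖ * ‖x - q‖⁻¹) • innerSL ℝ (x - q)

/-- the pair term `x ↦ V_LJ(‖x − q‖)` has Fréchet derivative `pairDeriv x q` at `x ≠ q`. -/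
theorem hasFDerivAt_pair {x q : E3} (hx : x ≠ q) :
    HasFDerivAt (fun y : E3 => lennardJones ‖y - q‖) (pairDeriv x q) x := by
  have hr : ‖x - q‖ ≠ 0 := norm_ne_zero_iff.mpr (sub_ne_zero.mpr hx)
  have h := (hasDerivAt_lennardJones hr).comp_hasFDerivAt x (hasFDerivAt_norm_sub hx)
  refine h.congr_fderiv ?_
  rw [pairDeriv, smul_smul]

/-- the pair derivative tested against a vector is minus the pair force paired with it. -/
theorem pairDeriv_apply (x q v : E3) : pairDeriv x q v = -⟪pairForce (x - q), v⟫ := by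
  simp only [pairDeriv, _root_.smul_apply, innerSL_apply_apply, smul_eq_mul, pairForce, inner_smul_left,
    RCLike.conj_to_real, ljDeriv]
  by_cases h : ‖x - q‖ = 0
  · simp [h]
  · field_simp
    ring

/-- norm bound on the pair derivative: `‖pairDeriv x q‖ ≤ r⁻¹³ + r⁻⁷`. -/
theorem norm_pairDeriv_le {x q : E3} (hx : x ≠ q) : ‖pairDeriv x q‖ ≤ (‖x - q‖⁻¹) ^ 13 + (‖x - q‖⁻¹) ^ 7 := by
  have hr : 0 < ‖x - q‖ := norm_pos_iff.mpr (sub_ne_zero.mpr hx)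
  unfold pairDeriv
  rw [norm_smul, innerSL_apply_norm, Real.norm_eq_abs, abs_mul, abs_of_pos (inv_pos.mpr hr), mul_assoc,
    inv_mul_cancel₀ hr.ne', mul_one]
  exact abs_ljDeriv_le hr


/-- the pair derivative is minus the Riesz image of the pair force. -/
theorem pairDeriv_eq (x q : E3) : pairDeriv x q = -innerSL ℝ (pairForce (x - q)) := by
  ext v
  rw [pairDeriv_apply, _root_.neg_apply, innerSL_apply_apply]

/-- hence `‖pairForce (x − q)‖ ≤ r⁻¹³ + r⁻⁷`. -/
theorem norm_pairForce_le {x q : E3} (hx : x ≠ q) : ‖pairForce (x - q)‖ ≤ (‖x - q‖⁻¹) ^ 13 + (‖x - q‖⁻¹) ^ 7 := by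
  rw [← innerSL_apply_norm ℝ (pairForce (x - q)), ← norm_neg, ← pairDeriv_eq]
  exact norm_pairDeriv_le hx

/-- `|V_LJ(r)| ≤ r⁻¹²/12 + r⁻⁶/6`. -/
theorem abs_lennardJones_le {r : ℝ} (hr : 0 < r) : |lennardJones r| ≤ (r⁻¹) ^ 12 / 12 + (r⁻¹) ^ 6 / 6 := by
  have h1 : 0 ≤ (r⁻¹) ^ 12 := pow_nonneg (inv_nonneg.mpr hr.le) _
  have h2 : 0 ≤ (r⁻¹) ^ 6 := pow_nonneg (inv_nonneg.mpr hr.le) _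
  unfold lennardJones
  rw [abs_le]; constructor <;> linarith

/-! ## 3. The site energy of a separated configuration is differentiable; Nash ⇒ zero net force -/

section Site

variable {δ : ℝ} {S : Set E3} {p : E3}

/-- the other atoms, as the index type of N's single-site sums. -/
abbrev Others (S : Set E3) (p : E3) : Type := {q : E3 // μS S {q} ≠ 0 ∧ q ≠ p}

/-- an element of `Others S p` is an atom of `S`. -/
theorem mem_of_others (q : Others S p) : (q : E3) ∈ S :=
  (Literature.Probability.Process.count_restrict_singleton_ne_zero_iff S q).1 q.2.1

/-- in a `δ`-separated configuration the other atoms are at distance `≥ δ` from `p ∈ S`. -/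
theorem le_norm_sub_of_others (hS : IsSep δ S) (hp : p ∈ S) (q : Others S p) : δ ≤ ‖p - (q : E3)‖ := by
  rw [← dist_eq_norm]
  exact hS p hp q (mem_of_others q) (fun h => q.2.2 h.symm)

/-- elementary: `r ≥ ρ/2 > 0 ⇒ r⁻ⁿ ≤ 2ⁿ ρ⁻ⁿ`. -/
theorem inv_pow_le_of_half_le {r ρ : ℝ} (hρ : 0 < ρ) (h : ρ / 2 ≤ r) (n : ℕ) : (r⁻¹) ^ n ≤ 2 ^ n * (ρ⁻¹) ^ n := by
  have hr : 0 < r := lt_of_lt_of_le (half_pos hρ) h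
  rw [← mul_pow]
  apply pow_le_pow_left₀ (inv_nonneg.mpr hr.le)
  rw [show (2 : ℝ) * ρ⁻¹ = (ρ / 2)⁻¹ by field_simp]
  exact inv_anti₀ (half_pos hρ) h

/-- elementary: `ρ ≥ δ > 0 ⇒ ρ⁻⁽⁶⁺ᵏ⁾ ≤ δ⁻ᵏ ρ⁻⁶`. -/
theorem inv_pow_add_le {ρ δ : ℝ} (hδ : 0 < δ) (h : δ ≤ ρ) (k : ℕ) : (ρ⁻¹) ^ (6 + k) ≤ (δ⁻¹) ^ k * (ρ⁻¹) ^ 6 := by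
  have hρ : 0 < ρ := lt_of_lt_of_le hδ h
  rw [pow_add, mul_comm]
  apply mul_le_mul_of_nonneg_right _ (pow_nonneg (inv_nonneg.mpr hρ.le) _)
  exact pow_le_pow_left₀ (inv_nonneg.mpr hρ.le) (inv_anti₀ hδ h) k

/-- on the ball `B(p, δ/2)` the pair derivatives are dominated by `K_δ · ‖p − q‖⁻⁶`. -/
theorem norm_pairDeriv_le_of_mem_ball (hδ : 0 < δ) (hS : IsSep δ S) (hp : p ∈ S) (q : Others S p) {y : E3}
    (hy : y ∈ ball p (δ / 2)) :
    ‖pairDeriv y q‖ ≤ (2 ^ 13 * (δ⁻¹) ^ 7 + 2 ^ 7 * δ⁻¹) * (‖p - (q : E3)‖⁻¹) ^ 6 := by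
  have hρ := le_norm_sub_of_others hS hp q
  have hρ0 : 0 < ‖p - (q : E3)‖ := lt_of_lt_of_le hδ hρ
  rw [mem_ball, dist_eq_norm] at hy
  have hr : ‖p - (q : E3)‖ / 2 ≤ ‖y - q‖ := by
    have := norm_sub_le_norm_sub_add_norm_sub p y (q : E3)
    have h' : ‖p - y‖ = ‖y - p‖ := norm_sub_rev _ _
    linarith
  have hyq : y ≠ q := by
    intro h; rw [h, sub_self, norm_zero] at hr; linarith
  have h13 := inv_pow_le_of_half_le hρ0 hr 13
  have h7 := inv_pow_le_of_half_le hρ0 hr 7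
  have h13' := inv_pow_add_le hδ hρ 7
  have h7' := inv_pow_add_le hδ hρ 1
  rw [show 6 + 7 = 13 from rfl] at h13'
  rw [show 6 + 1 = 7 from rfl, pow_one] at h7'
  calc ‖pairDeriv y q‖ ≤ (‖y - (q : E3)‖⁻¹) ^ 13 + (‖y - (q : E3)‖⁻¹) ^ 7 := norm_pairDeriv_le hyq
    _ ≤ 2 ^ 13 * (‖p - (q : E3)‖⁻¹) ^ 13 + 2 ^ 7 * (‖p - (q : E3)‖⁻¹) ^ 7 := add_le_add h13 h7
    _ ≤ 2 ^ 13 * ((δ⁻¹) ^ 7 * (‖p - (q : E3)‖⁻¹) ^ 6) + 2 ^ 7 * (δ⁻¹ * (‖p - (q : E3)‖⁻¹) ^ 6) := by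
      gcongr
    _ = (2 ^ 13 * (δ⁻¹) ^ 7 + 2 ^ 7 * δ⁻¹) * (‖p - (q : E3)‖⁻¹) ^ 6 := by ring

/-- N's single-site energy of `p` displaced to `y`. -/
def siteEnergy (S : Set E3) (p y : E3) : ℝ := ∑' q : Others S p, lennardJones (dist y (q : E3))

/-- ★ the site energy is differentiable at `p`, with derivative the sum of the pair derivatives, provided the inverse sixth powers of the
distances to the other atoms are summable (true for separated sets: §4). -/
theorem hasFDerivAt_siteEnergy (hδ : 0 < δ) (hS : IsSep δ S) (hp : p ∈ S)
    (h6 : Summable (fun q : Others S p => (‖p - (q : E3)‖⁻¹) ^ 6)) :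
    HasFDerivAt (siteEnergy S p) (∑' q : Others S p, pairDeriv p q) p ∧ Summable (fun q : Others S p => pairDeriv p q) := by
  set K : ℝ := 2 ^ 13 * (δ⁻¹) ^ 7 + 2 ^ 7 * δ⁻¹ with hK
  have hu : Summable (fun q : Others S p => K * (‖p - (q : E3)‖⁻¹) ^ 6) := h6.mul_left K
  have hderiv : ∀ q : Others S p, ∀ y ∈ ball p (δ / 2), HasFDerivAt (fun y : E3 => lennardJones ‖y - q‖) (pairDeriv y q) y := by
    intro q y hy
    apply hasFDerivAt_pair
    intro h
    have hρ := le_norm_sub_of_others hS hp q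
    rw [mem_ball, dist_eq_norm, h, norm_sub_rev] at hy
    linarith
  have hbound : ∀ q : Others S p, ∀ y ∈ ball p (δ / 2), ‖pairDeriv y q‖ ≤ K * (‖p - (q : E3)‖⁻¹) ^ 6 :=
    fun q y hy => norm_pairDeriv_le_of_mem_ball hδ hS hp q hy
  have hp0 : p ∈ ball p (δ / 2) := mem_ball_self (half_pos hδ)
  have hsum0 : Summable (fun q : Others S p => lennardJones ‖p - (q : E3)‖) := by
    refine Summable.of_norm_bounded (g := fun q : Others S p => ((δ⁻¹) ^ 6 / 12 + 1 / 6) * (‖p - (q : E3)‖⁻¹) ^ 6)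
      (h6.mul_left _) fun q => ?_
    have hρ := le_norm_sub_of_others hS hp q
    have hρ0 : 0 < ‖p - (q : E3)‖ := lt_of_lt_of_le hδ hρ
    have h12 := inv_pow_add_le hδ hρ 6
    rw [show 6 + 6 = 12 from rfl] at h12
    rw [Real.norm_eq_abs]
    calc |lennardJones ‖p - (q : E3)‖| ≤ (‖p - (q : E3)‖⁻¹) ^ 12 / 12 + (‖p - (q : E3)‖⁻¹) ^ 6 / 6 := abs_lennardJones_le hρ0
      _ ≤ ((δ⁻¹) ^ 6 * (‖p - (q : E3)‖⁻¹) ^ 6) / 12 + (‖p - (q : E3)‖⁻¹) ^ 6 / 6 := by gcongr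
      _ = ((δ⁻¹) ^ 6 / 12 + 1 / 6) * (‖p - (q : E3)‖⁻¹) ^ 6 := by ring
  have hmain := hasFDerivAt_tsum_of_isPreconnected hu isOpen_ball (convex_ball p (δ / 2)).isPreconnected hderiv hbound hp0
    hsum0 hp0
  have hfun : (fun y : E3 => ∑' q : Others S p, lennardJones ‖y - (q : E3)‖) = siteEnergy S p := by
    funext y; simp only [siteEnergy, dist_eq_norm]
  rw [hfun] at hmain
  refine ⟨hmain, ?_⟩
  exact Summable.of_norm_bounded hu fun q => hbound q p hp0

/-- ★ **Nash force balance**: at an atom `p` of a `δ`-separated single-site-Nash configuration the LJ pair forces from all other atoms sum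
to zero (as a convergent sum), given the summability of the inverse sixth powers (§4 discharges it). -/
theorem hasSum_pairForce_of_isNash (hδ : 0 < δ) (hS : IsSep δ S) (hN : IsNash (μS S)) (hp : p ∈ S)
    (h6 : Summable (fun q : Others S p => (‖p - (q : E3)‖⁻¹) ^ 6)) :
    HasSum (fun q : Others S p => pairForce (p - q)) 0 := by
  obtain ⟨hD, hsum⟩ := hasFDerivAt_siteEnergy hδ hS hp h6
  -- local minimality from single-site Nash stationarity
  have hp' : μS S {p} ≠ 0 := (Literature.Probability.Process.count_restrict_singleton_ne_zero_iff S p).2 hp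
  have hmin : IsLocalMin (siteEnergy S p) p := by
    refine Filter.eventually_of_mem (ball_mem_nhds p (half_pos hδ)) fun y hy => ?_
    refine hN p hp' y fun q hq hqp hyq => ?_
    have hqS : q ∈ S := (Literature.Probability.Process.count_restrict_singleton_ne_zero_iff S q).1 hq
    have hd : δ ≤ dist p q := hS p hp q hqS (Ne.symm hqp)
    rw [mem_ball, hyq, dist_comm] at hy
    linarith
  have hzero : (∑' q : Others S p, pairDeriv p q) = 0 := hmin.hasFDerivAt_eq_zero hD
  -- pass through the Riesz map
  have hF : Summable (fun q : Others S p => pairForce (p - q)) := by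
    refine Summable.of_norm_bounded (g := fun q => ‖pairDeriv p q‖) hsum.norm fun q => ?_
    rw [pairDeriv_eq, norm_neg, innerSL_apply_norm]
  have hrw : (∑' q : Others S p, pairDeriv p q) = -innerSL ℝ (∑' q : Others S p, pairForce (p - q)) := by
    rw [ContinuousLinearMap.map_tsum _ hF, ← tsum_neg]
    exact tsum_congr fun q => pairDeriv_eq p q
  rw [hrw, neg_eq_zero] at hzero
  have hnorm : ‖∑' q : Others S p, pairForce (p - (q : E3))‖ = 0 := by
    rw [← innerSL_apply_norm ℝ, hzero, norm_zero]
  rw [norm_eq_zero] at hnorm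
  rw [← hnorm]
  exact hF.hasSum

end Site

end Summit.AtomisticToContinuum.Crystallization.Theorems.ChartedPlanarOrderNashForceBalance

end
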